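import Summits.BirchSwinnertonDyer.Rank1Residual.X4.KuriharaTestFunctionsDisjoint
import HarnessLib

/-!
# Lemma S, part 2/3: a unitriangular solve over a commutative ring, CRT points of `(ℤ/D)ˣ`, and the DIAGONAL BLOCK `g ↦ (∑_x g(x) W_M(x))_{M ⊆ P(D)}` is onto (cell `b2b-bsdres`, seat additive-p4 gen 31, line V51′/V52-A)

HONEST FRAMING (verbatim, cell `b2b-bsdres`): the goal of the cell is to DELETE the COMBINATION-SHAPED
residual classes for ALL analytic-rank `≤ 1` curves over `ℚ` — "full BSD formula for every rank `≤ 1`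
curve in class `C`" assembled STRICTLY from published theorems — so that the rank-`≤ 1` remainder
becomes exactly the CONSTRUCTION-SHAPED classes, which are TYPED (missing-input Props), NOT attempted;
this is not "finishing BSD". This file: a research-route KERNEL LEMMA file (pure algebra over an arbitrary
commutative ring; no named fact, no conjecture, nothing booked; X4 stays CONSTRUCTION-SHAPED).

## What is proved

* **`forall_of_unitriangular`** — a generic solve: if a set `S` of vectors `ι → R` is closed under `0`,
  `+` and scalars and contains, for every index `i`, a vector `v` with `v i = 1` whose other non-zero
  entries sit at indices of STRICTLY LARGER rank, then `S` is everything (descending induction on the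
  rank). Used twice in lemma S: for the diagonal block below and for the assembly over pairs (part 3).
* `exists_unit_forall_unitsMap_eq` — CRT for units: for `D` square-free and any prescribed units
  `u_q ∈ (ℤ/q)ˣ`, a unit `x` of `ℤ/D` with `x ≡ u_q (mod q)` at every prime `q ∣ D`.
* `exists_unit_weight_eq` — with `ψ_q(u_q) = 1` (additively) available at the primes of `D`, the point
  `x(M₀)` (`≡ u_q` on `M₀`, `≡ 1` off `M₀`) has weights `W_M(x(M₀)) = [M ⊆ M₀]` for all `M ⊆ P(D)`
  (`W_M = ∏_{q∈M} ψ_q`, `ψ_q(1) = 0`).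
* **`exists_blockSolve`** — for every target `c`, a function `g` on `(ℤ/D)ˣ` with
  `∑_x g(x) W_M(x) = c(M)` for all `M ⊆ P(D)`: the matrix `([M ⊆ M₀])` is unitriangular for the rank
  `|P(D) ∖ M|`.

## References

* M. Kurihara, Contrib. Math. Comput. Sci. 7 (2014) 317–356, §1.1. [cite: Kurihara2014, §1.1]
* B. Mazur, J. Tate, J. Teitelbaum, Invent. Math. 84 (1986), §I.4 (4.2). [cite: MazurTateTeitelbaum1986Invent, §I.4 (4.2)]
-/

noncomputable section

open scoped MatrixGroups ModularForm

open CongruenceSubgroup Finset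

open Literature.NumberTheory.EllipticCurves Literature.NumberTheory.EllipticCurves.ModularForms

namespace Summit.BirchSwinnertonDyer.Rank1Residual.LevelLowering

variable {R : Type*} [CommRing R]

/-! ### §1 A unitriangular solve over a commutative ring -/

section Unitriangular

/-- **UNITRIANGULAR SOLVE.** Let `S` be a set of vectors `ι → R` (`ι` finite) containing `0` and closed
under addition and scalar multiplication, and `rank : ι → ℕ`. If for every `i` there is `v ∈ S` with
`v i = 1` and `v j ≠ 0 ⇒ rank i < rank j` for `j ≠ i`, then every vector lies in `S`. (Descending
induction on the rank: subtract `∑_{rank i = r} w(i)·v_i` to clear the layer `r`.) [folklore] -/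
theorem forall_of_unitriangular {ι : Type*} [Fintype ι] [DecidableEq ι] (rank : ι → ℕ)
    (S : (ι → R) → Prop) (h0 : S 0) (hadd : ∀ v w, S v → S w → S (v + w))
    (hsmul : ∀ (c : R) (v : ι → R), S v → S (c • v))
    (hgen : ∀ i, ∃ v, S v ∧ v i = 1 ∧ ∀ j, j ≠ i → v j ≠ 0 → rank i < rank j) :
    ∀ w, S w := by
  classical
  choose v hvS hvi hvlt using hgen
  have hsum : ∀ (s : Finset ι) (f : ι → ι → R), (∀ i ∈ s, S (f i)) → S (∑ i ∈ s, f i) := by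
    intro s f hf
    induction s using Finset.induction_on with
    | empty => rw [Finset.sum_empty]; exact h0
    | insert a s ha ih =>
      rw [Finset.sum_insert ha]
      exact hadd _ _ (hf a (Finset.mem_insert_self a s))
        (ih fun i hi ↦ hf i (Finset.mem_insert_of_mem hi))
  obtain ⟨N, hN⟩ : ∃ N, ∀ j, rank j < N :=
    ⟨Finset.univ.sup rank + 1, fun j ↦
      Nat.lt_succ_of_le (Finset.le_sup (f := rank) (Finset.mem_univ j))⟩
  -- `key k`: every vector supported on ranks `≥ N - k` lies in `S`
  have key : ∀ k : ℕ, ∀ w : ι → R, (∀ j, w j ≠ 0 → N ≤ rank j + k) → S w := by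
    intro k
    induction k with
    | zero =>
      intro w hw
      have hw0 : w = 0 := by
        funext j
        by_contra h
        have h1 := hw j h
        have h2 := hN j
        omega
      rw [hw0]
      exact h0
    | succ k ihk =>
      intro w hw
      let I₀ : Finset ι := Finset.univ.filter fun i ↦ rank i + (k + 1) = N
      have hv0 : ∀ i ∈ I₀, ∀ j, rank j + (k + 1) ≤ N → j ≠ i → v i j = 0 := by
        intro i hi j hj hji
        by_contra hne
        have h1 := hvlt i j hji hne
        have h2 : rank i + (k + 1) = N := (Finset.mem_filter.mp hi).2
        omega
      have hw' : ∀ j, (w - ∑ i ∈ I₀, w i • v i) j ≠ 0 → N ≤ rank j + k := by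
        intro j hj
        by_contra hlt
        apply hj
        have hle : rank j + (k + 1) ≤ N := by omega
        rw [Pi.sub_apply, Finset.sum_apply]
        simp only [Pi.smul_apply, smul_eq_mul]
        rcases hle.lt_or_eq with hlt' | heq
        · -- strictly below the layer: `w j = 0` and every `v_i j = 0`
          have hwj : w j = 0 := by
            by_contra h
            have := hw j h
            omega
          rw [hwj, Finset.sum_eq_zero, sub_zero]
          intro i hi
          have hji : j ≠ i := by
            rintro rfl
            have := (Finset.mem_filter.mp hi).2
            omega
          rw [hv0 i hi j hle hji, mul_zero]
        · -- on the layer: only `v_j j = 1` contributes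
          have hjI : j ∈ I₀ := Finset.mem_filter.mpr ⟨Finset.mem_univ j, heq⟩
          rw [← Finset.add_sum_erase I₀ _ hjI, hvi j, mul_one, Finset.sum_eq_zero, add_zero,
            sub_self]
          intro i hi
          obtain ⟨hij, hiI⟩ := Finset.mem_erase.mp hi
          rw [hv0 i hiI j hle (Ne.symm hij), mul_zero]
      have h1 : S (w - ∑ i ∈ I₀, w i • v i) := ihk _ hw'
      have h2 : S (∑ i ∈ I₀, w i • v i) :=
        hsum I₀ (fun i ↦ w i • v i) fun i _ ↦ hsmul _ _ (hvS i)
      have hw_eq : w = (w - ∑ i ∈ I₀, w i • v i) + ∑ i ∈ I₀, w i • v i :=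
        (sub_add_cancel w _).symm
      rw [hw_eq]
      exact hadd _ _ h1 h2
  exact fun w ↦ key N w fun j _ ↦ Nat.le_add_left N (rank j)

end Unitriangular

/-! ### §2 CRT points of `(ℤ/D)ˣ` for square-free `D` -/

section CRT

/-- **CRT for units**: for `D` square-free and prescribed units `u_q ∈ (ℤ/q)ˣ`, there is a unit `x`
of `ℤ/D` reducing to `u_q` at every prime `q ∣ D`. [folklore] -/
theorem exists_unit_forall_unitsMap_eq {D : ℕ} (hD : Squarefree D) (u : (q : ℕ) → (ZMod q)ˣ) :
    ∃ x : (ZMod D)ˣ, ∀ (q : ℕ) (hq : q ∈ D.primeFactors),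
      ZMod.unitsMap (Nat.dvd_of_mem_primeFactors hq) x = u q := by
  haveI : NeZero D := ⟨hD.ne_zero⟩
  let a : ℕ → ℕ := fun q ↦ ((u q : ZMod q).val)
  have hs : ∀ q ∈ D.primeFactors, (fun q : ℕ ↦ q) q ≠ 0 :=
    fun q hq ↦ (Nat.prime_of_mem_primeFactors hq).ne_zero
  have hpp : Set.Pairwise (D.primeFactors : Set ℕ) (Function.onFun Nat.Coprime fun q : ℕ ↦ q) := by
    intro q hq q' hq' hne
    exact (Nat.coprime_primes (Nat.prime_of_mem_primeFactors hq)
      (Nat.prime_of_mem_primeFactors hq')).mpr hne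
  obtain ⟨k, hk⟩ := Nat.chineseRemainderOfFinset a (fun q ↦ q) D.primeFactors hs hpp
  -- `k` is prime to `D`
  have hcop : k.Coprime D := by
    refine Nat.coprime_of_dvd fun p hp hpk hpD ↦ ?_
    have hpmem : p ∈ D.primeFactors := Nat.mem_primeFactors.mpr ⟨hp, hpD, hD.ne_zero⟩
    have hmod : k ≡ a p [MOD p] := hk p hpmem
    have hpa : p ∣ a p := (Nat.ModEq.dvd_iff hmod (dvd_refl p)).mp hpk
    have hcopa : (a p).Coprime p := ZMod.val_coe_unit_coprime (u p)
    exact hp.one_lt.ne' (Nat.Coprime.eq_one_of_dvd hcopa.symm hpa)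
  refine ⟨ZMod.unitOfCoprime k hcop, fun q hq ↦ Units.ext ?_⟩
  have hqd : q ∣ D := Nat.dvd_of_mem_primeFactors hq
  haveI : NeZero q := ⟨(Nat.prime_of_mem_primeFactors hq).ne_zero⟩
  rw [ZMod.unitsMap_val, ZMod.coe_unitOfCoprime, ZMod.cast_natCast hqd,
    (ZMod.natCast_eq_natCast_iff _ _ _).mpr (hk q hq), ZMod.natCast_zmod_val]

/-- **Weights at the CRT points**: with a unit `u_q` of additive character value `ψ_q(u_q) = 1` at each
prime `q ∣ D`, the point `x(M₀) ∈ (ℤ/D)ˣ` (`≡ u_q` for `q ∈ M₀`, `≡ 1` otherwise) has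
`W_M(x(M₀)) = [M ⊆ M₀]` for every `M ⊆ P(D)` (`W_M = ∏_{q ∈ M} ψ_q`, `ψ_q(1) = 0`). [folklore] -/
theorem exists_unit_weight_eq {D : ℕ} (hD : Squarefree D)
    (ψ : (ℓ : ℕ) → (ZMod ℓ)ˣ →* Multiplicative R)
    (hψ : ∀ q ∈ D.primeFactors, ∃ u : (ZMod q)ˣ, ψ q u = Multiplicative.ofAdd 1)
    (M₀ : Finset ℕ) :
    ∃ x : (ZMod D)ˣ, ∀ M ⊆ D.primeFactors, weight ψ D M x = if M ⊆ M₀ then 1 else 0 := by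
  classical
  haveI : NeZero D := ⟨hD.ne_zero⟩
  choose u hu using hψ
  let u' : (q : ℕ) → (ZMod q)ˣ := fun q ↦
    if h : q ∈ D.primeFactors then (if q ∈ M₀ then u q h else 1) else 1
  obtain ⟨x, hx⟩ := exists_unit_forall_unitsMap_eq hD u'
  refine ⟨x, fun M hM ↦ ?_⟩
  have hchi : ∀ q ∈ D.primeFactors, chi ψ D q x = if q ∈ M₀ then 1 else 0 := by
    intro q hq
    rw [chi_of_dvd ψ (Nat.dvd_of_mem_primeFactors hq), hx q hq]
    simp only [u', dif_pos hq]
    split_ifs with h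
    · rw [hu q hq]; rfl
    · rw [map_one]; rfl
  unfold weight
  by_cases hMM : M ⊆ M₀
  · rw [if_pos hMM]
    exact Finset.prod_eq_one fun q hq ↦ by rw [hchi q (hM hq), if_pos (hMM hq)]
  · rw [if_neg hMM]
    obtain ⟨q, hqM, hqM₀⟩ := Finset.not_subset.mp hMM
    exact Finset.prod_eq_zero hqM (by rw [hchi q (hM hqM), if_neg hqM₀])

end CRT

/-! ### §3 The diagonal block is onto -/

section Block

/-- **THE DIAGONAL BLOCK IS ONTO.** For `D` square-free and `ψ_q` taking the value `1` (additively) at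
some unit for every prime `q ∣ D`: every target `c` on the subsets of `P(D)` is of the form
`c(M) = ∑_{x ∈ (ℤ/D)ˣ} g(x) · W_M(x)` (`M ⊆ P(D)`) for some `g`. The indicator of the point `x(M₀)`
gives the vector `([M ⊆ M₀])_M`, unitriangular for the rank `|P(D) ∖ M|`. [folklore] -/
theorem exists_blockSolve {D : ℕ} [NeZero D] (hD : Squarefree D)
    (ψ : (ℓ : ℕ) → (ZMod ℓ)ˣ →* Multiplicative R)
    (hψ : ∀ q ∈ D.primeFactors, ∃ u : (ZMod q)ˣ, ψ q u = Multiplicative.ofAdd 1)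
    (c : Finset ℕ → R) :
    ∃ g : (ZMod D)ˣ → R, ∀ M ⊆ D.primeFactors, ∑ x : (ZMod D)ˣ, g x * weight ψ D M x = c M := by
  classical
  let S : (↥(D.primeFactors.powerset) → R) → Prop := fun w ↦
    ∃ g : (ZMod D)ˣ → R, ∀ M : ↥(D.primeFactors.powerset),
      ∑ x : (ZMod D)ˣ, g x * weight ψ D M.1 x = w M
  have h0 : S 0 := ⟨fun _ ↦ 0, fun M ↦ by simp⟩
  have hadd : ∀ v w, S v → S w → S (v + w) := by
    rintro v w ⟨g₁, hg₁⟩ ⟨g₂, hg₂⟩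
    refine ⟨fun x ↦ g₁ x + g₂ x, fun M ↦ ?_⟩
    rw [Pi.add_apply, ← hg₁ M, ← hg₂ M, ← Finset.sum_add_distrib]
    exact Finset.sum_congr rfl fun x _ ↦ add_mul _ _ _
  have hsmul : ∀ (a : R) (v : ↥(D.primeFactors.powerset) → R), S v → S (a • v) := by
    rintro a v ⟨g, hg⟩
    refine ⟨fun x ↦ a * g x, fun M ↦ ?_⟩
    rw [Pi.smul_apply, smul_eq_mul, ← hg M, Finset.mul_sum]
    exact Finset.sum_congr rfl fun x _ ↦ mul_assoc _ _ _
  have hgen : ∀ M₀ : ↥(D.primeFactors.powerset), ∃ v, S v ∧ v M₀ = 1 ∧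
      ∀ M, M ≠ M₀ → v M ≠ 0 →
        (D.primeFactors \ M₀.1).card < (D.primeFactors \ M.1).card := by
    intro M₀
    obtain ⟨pt, hpt⟩ := exists_unit_weight_eq hD ψ hψ M₀.1
    refine ⟨fun M ↦ if M.1 ⊆ M₀.1 then (1 : R) else 0, ?_, if_pos subset_rfl, ?_⟩
    · refine ⟨fun x ↦ if x = pt then 1 else 0, fun M ↦ ?_⟩
      simp only [ite_mul, one_mul, zero_mul, Finset.sum_ite_eq', Finset.mem_univ, if_true]
      exact hpt M.1 (Finset.mem_powerset.mp M.2)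
    · intro M hne hv
      have hsub : M.1 ⊆ M₀.1 := by
        by_contra h
        exact hv (if_neg h)
      have hne' : M.1 ≠ M₀.1 := fun h ↦ hne (Subtype.ext h)
      have hss : M.1 ⊂ M₀.1 := Finset.ssubset_iff_subset_ne.mpr ⟨hsub, hne'⟩
      have hM₀P : M₀.1 ⊆ D.primeFactors := Finset.mem_powerset.mp M₀.2
      have hMP : M.1 ⊆ D.primeFactors := Finset.mem_powerset.mp M.2
      rw [Finset.card_sdiff_of_subset hM₀P, Finset.card_sdiff_of_subset hMP]
      have h1 := Finset.card_lt_card hss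
      have h2 := Finset.card_le_card hM₀P
      omega
  have hall := forall_of_unitriangular (fun M : ↥(D.primeFactors.powerset) ↦
    (D.primeFactors \ M.1).card) S h0 hadd hsmul hgen
  obtain ⟨g, hg⟩ := hall fun M ↦ c M.1
  exact ⟨g, fun M hM ↦ hg ⟨M, Finset.mem_powerset.mpr hM⟩⟩

end Block

end Summit.BirchSwinnertonDyer.Rank1Residual.LevelLowering

end
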